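import Literature.NumberTheory.Automorphic.IntegratedOperator
import Literature.NumberTheory.Automorphic.CosetIntegral
import Literature.NumberTheory.Automorphic.SmoothRepresentation
import HarnessLib

/-!
# The integrated operator on the image of a smooth vector is a finite Hecke sum:
# `π(φ) (f x) = f (Σ_{γ ∈ G/K} (∫_{γK} φ) • ρ(γ̃) x)`
(Jacquet–Langlands, LNM 114 (1970), §16, pp. 502–503: "`ρ'(Φ')` coincides with `τ'(f)` on `M'`";
Gelbart, *Automorphic forms on adele groups* (1975), §10, (10.12)–(10.13); Bump, *Automorphic
Forms and Representations* (1997), §3.4 and Prop. 4.2.3 (the action of the Hecke algebra on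
smooth vectors))

Topic `NumberTheory/Automorphic`; theorems only (no definition, no named fact, no instance). In
the comparison of trace formulas proving the Jacquet–Langlands correspondence the test function
`Φ = (∏_{v ∈ S} ξ_v) ⊗ F` acts, on an automorphic representation with a prescribed local
component `π_v` at `v ∈ S`, through the *algebraic* action `π_v(ξ_v) = Σ` (finite sum) of the
Hecke algebra on smooth vectors — e.g. `π_v(ξ_v) u = u` for the normalised matrix coefficient
`ξ_v` of a supercuspidal `π_v` (orthogonality relations, Gelbart (10.11)), which is how the
non-vanishing of `R(Φ)` on the relevant constituents and the identities (10.12)–(10.13) are seen.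
The tree models "local component" by a non-zero linear map `f : V_ρ → W` from an abstract smooth
representation `ρ` of `GL_n(K_v)` (no topology on `V_ρ`) into the Hilbert space `W ⊆ L²`,
intertwining `ρ` with the unitary representation along the local embedding
(`HasLocalComponentAt`, `GLnAdelicStructure`). This file provides the bridge between the Bochner
integral `π(φ) = ∫ φ(g) π(g) dμ(g)` (`ContRepresentation.integratedOperator`, `IntegratedOperator`)
and that algebraic action, for an arbitrary topological group `G` with a left invariant measure
`μ`:

* `exists_finset_tsupport_subset_biUnion_coset` — the compact support of `φ ∈ C_c(G)` is
  covered by finitely many left cosets `γ K` of an open subgroup `K`.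
* `integral_smul_eq_sum_setIntegral_smul` — **for `F : G → E` right-`K`-invariant (`K` open) and
  `φ ∈ C_c(G)`: `∫ φ(g) • F(g) dμ = Σ_{γ ∈ T} (∫_{γK} φ dμ) • F(γ̃)`** for every finite set `T` of
  cosets covering the support of `φ` (`γ̃ = γ.out`; the fibres `γ K` are the sets
  `{x : xK = γ}` of `CosetIntegral`).
* `ContRepresentation.integratedOperator_apply_eq_sum_of_intertwines` — **for a representation
  `π` of `G` by bounded operators on a Hilbert space (unitary, strongly continuous), an abstract
  representation `ρ` of `G` on `V`, a linear `f : V → H` with `f (ρ g x) = π g (f x)`, and a vector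
  `x` with open stabiliser in `ρ` (a smooth vector):
  `π(φ) (f x) = f (Σ_{γ ∈ T} (∫_{γ K} φ dμ) • ρ γ̃ x)`**, `K = Stab_ρ(x)`, for every finite `T`
  covering the support of `φ`. In particular `π(φ) (f x) ∈ range f`
  (`integratedOperator_apply_mem_range_of_intertwines`), and for injective `f` (e.g. `ρ`
  irreducible) `π(φ) (f x) = 0` iff the Hecke sum vanishes
  (`integratedOperator_apply_eq_zero_iff_of_intertwines`).

## References

* H. Jacquet, R. P. Langlands, *Automorphic forms on `GL(2)`*, LNM 114 (1970), §16, pp. 502–503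
  [JacquetLanglands1970].
* S. Gelbart, *Automorphic forms on adele groups*, Ann. of Math. Studies 83 (1975), §10,
  (10.11)–(10.13), pp. 152–153 [Gelbart1975].
* D. Bump, *Automorphic Forms and Representations* (1997), §3.4, Prop. 4.2.3 [Bump1997].
-/

noncomputable section

open MeasureTheory Measure Set Filter Topology CompactlySupported
open scoped Pointwise

namespace Literature.NumberTheory.Automorphic

/-! ### Covering the support of a test function by finitely many cosets -/

section Cover

variable {G : Type*} [Group G] [TopologicalSpace G] [IsTopologicalGroup G] (K : Subgroup G)

/-- The compact support of `φ ∈ C_c(G)` is covered by finitely many left cosets of an open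
subgroup `K` (the cosets `{x : xK = γ}` are open). [folklore] -/
theorem exists_finset_tsupport_subset_biUnion_coset (hK : IsOpen (K : Set G)) {𝕜 : Type*}
    [Zero 𝕜] [TopologicalSpace 𝕜] {φ : G → 𝕜} (hφs : HasCompactSupport φ) :
    ∃ T : Finset (G ⧸ K), tsupport φ ⊆ ⋃ γ ∈ T, {x : G | (x : G ⧸ K) = γ} := by
  obtain ⟨T, hT⟩ := hφs.elim_finite_subcover (fun γ : G ⧸ K => {x : G | (x : G ⧸ K) = γ})
    (fun γ => isOpen_setOf_mk_eq hK γ) (fun x _ => Set.mem_iUnion.2 ⟨(x : G ⧸ K), rfl⟩)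
  exact ⟨T, hT⟩

end Cover

/-! ### Integrals of `φ • F` with `F` right-`K`-invariant -/

section Integral

variable {G : Type*} [Group G] [TopologicalSpace G] [IsTopologicalGroup G] [MeasurableSpace G]
  [BorelSpace G] {K : Subgroup G}
  {E : Type*} [NormedAddCommGroup E] [NormedSpace ℂ E] [CompleteSpace E]
  {μ : Measure G}

omit [MeasurableSpace G] [BorelSpace G] [NormedSpace ℂ E] [CompleteSpace E] in
/-- A right-`K`-invariant function (`K` open) is locally constant, hence continuous: it is
constant on the open cosets `x K`. [folklore] -/
theorem continuous_of_right_invariant (hK : IsOpen (K : Set G)) {F : G → E}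
    (hF : ∀ x : G, ∀ k ∈ K, F (x * k) = F x) : Continuous F := by
  refine (IsLocallyConstant.iff_exists_open F).2 (fun x => ?_) |>.continuous
  refine ⟨{y : G | (y : G ⧸ K) = (x : G ⧸ K)}, isOpen_setOf_mk_eq hK _, rfl, fun y hy => ?_⟩
  rw [apply_eq_apply_out_of_mk_eq K hF hy, apply_eq_apply_out_of_mk_eq K hF (rfl : (x : G ⧸ K) = x)]

/-- **`∫ φ • F = Σ_γ (∫_{γK} φ) • F(γ̃)` for `F` right-`K`-invariant.** Let `K` be an open subgroup,
`F : G → E` right-`K`-invariant, `φ : G → ℂ` continuous with compact support, and `T` a finite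
set of left cosets covering the support of `φ`. Then
`∫ φ(g) • F(g) dμ(g) = Σ_{γ ∈ T} (∫_{{x : xK = γ}} φ dμ) • F(γ.out)` (the fibres are disjoint and
open, `F` is constant on each, and `φ` vanishes off their union). [folklore] -/
theorem integral_smul_eq_sum_setIntegral_smul [IsFiniteMeasureOnCompacts μ]
    (hK : IsOpen (K : Set G)) {F : G → E} (hF : ∀ x : G, ∀ k ∈ K, F (x * k) = F x)
    {φ : G → ℂ} (hφ : Continuous φ) (hφs : HasCompactSupport φ) {T : Finset (G ⧸ K)}
    (hT : tsupport φ ⊆ ⋃ γ ∈ T, {x : G | (x : G ⧸ K) = γ}) :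
    ∫ g, φ g • F g ∂μ = ∑ γ ∈ T, (∫ g in {x : G | (x : G ⧸ K) = γ}, φ g ∂μ) • F γ.out := by
  classical
  have hFc : Continuous F := continuous_of_right_invariant hK hF
  have hint : Integrable (fun g => φ g • F g) μ :=
    (hφ.smul hFc).integrable_of_hasCompactSupport hφs.smul_right
  -- the integrand vanishes off the union of the cosets of `T`
  set S : Set G := ⋃ γ ∈ T, {x : G | (x : G ⧸ K) = γ} with hS
  have hSm : MeasurableSet S :=
    MeasurableSet.biUnion T.countable_toSet fun γ _ => measurableSet_setOf_mk_eq hK γ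
  have hzero : ∀ g ∉ S, φ g • F g = 0 := fun g hg => by
    rw [image_eq_zero_of_notMem_tsupport (fun h => hg (hT h)), zero_smul]
  have h1 : ∫ g, φ g • F g ∂μ = ∫ g in S, φ g • F g ∂μ := by
    rw [← integral_indicator hSm]
    refine integral_congr_ae (Eventually.of_forall fun g => ?_)
    change φ g • F g = S.indicator (fun g => φ g • F g) g
    by_cases hg : g ∈ S
    · rw [Set.indicator_of_mem hg]
    · rw [Set.indicator_of_notMem hg, hzero g hg]
  rw [h1, hS, integral_biUnion_finset T (fun γ _ => measurableSet_setOf_mk_eq hK γ)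
    (fun γ _ γ' _ hne => disjoint_setOf_mk_eq K hne) (fun γ _ => hint.integrableOn)]
  refine Finset.sum_congr rfl fun γ _ => ?_
  -- on the coset `γ K`, `F = F γ.out`
  have hconst : Set.EqOn (fun g => φ g • F g) (fun g => φ g • F γ.out)
      {x : G | (x : G ⧸ K) = γ} := fun g hg => by
    simp only []
    rw [apply_eq_apply_out_of_mk_eq K hF hg]
  rw [setIntegral_congr_fun (measurableSet_setOf_mk_eq hK γ) hconst, integral_smul_const]

end Integral

/-! ### The integrated operator on the image of a smooth vector -/

section Representation

variable {G : Type*} [Group G] [TopologicalSpace G] [IsTopologicalGroup G] [MeasurableSpace G]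
  [BorelSpace G]
  {H : Type*} [NormedAddCommGroup H] [InnerProductSpace ℂ H] [CompleteSpace H]
  {π : ContRepresentation ℂ G H}
  {V : Type*} [AddCommGroup V] [Module ℂ V] {ρ : Representation ℂ G V}

omit [TopologicalSpace G] [IsTopologicalGroup G] [MeasurableSpace G] [BorelSpace G]
  [CompleteSpace H] in
/-- `g ↦ f (ρ g x)` is right-invariant under the stabiliser of `x`. [folklore] -/
theorem apply_apply_mul_of_mem_stabilizerSubgroup (f : V →ₗ[ℂ] H) (x : V) (g : G) {k : G}
    (hk : k ∈ ρ.stabilizerSubgroup x) : f (ρ (g * k) x) = f (ρ g x) := by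
  rw [map_mul, Module.End.mul_apply, (ρ.mem_stabilizerSubgroup x k).1 hk]

/-- **The integrated operator on the image of a smooth vector is a finite Hecke sum.** Let `π` be
a unitary strongly continuous representation of `G` on a Hilbert space, `μ` a measure on `G`
finite on compact sets, `ρ` an abstract representation of `G` on `V`, `f : V → H` linear with
`f (ρ g x) = π g (f x)` for all `g`, and `x ∈ V` a smooth vector (open stabiliser `K`). For every
`φ ∈ C_c(G)` and every finite set `T` of cosets of `K` covering the support of `φ`:
`π(φ) (f x) = f (Σ_{γ ∈ T} (∫_{γ K} φ dμ) • ρ(γ.out) x)`. (Bump (1997), §3.4 / Prop. 4.2.3: the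
action of the Hecke algebra on smooth vectors; this is how `R(Φ)` is computed on a constituent
with a given local component in Jacquet–Langlands (1970), p. 503 and Gelbart (1975),
(10.12)–(10.13).) [cite: Gelbart1975, (10.12)–(10.13)] -/
theorem ContRepresentation.integratedOperator_apply_eq_sum_of_intertwines (hu : π.IsUnitary)
    (hc : π.IsStronglyContinuous) (μ : Measure G) [IsFiniteMeasureOnCompacts μ]
    (f : V →ₗ[ℂ] H) (hf : ∀ (g : G) (y : V), f (ρ g y) = π g (f y)) {x : V}
    (hx : ρ.IsSmoothVector x) (φ : C_c(G, ℂ)) {T : Finset (G ⧸ ρ.stabilizerSubgroup x)}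
    (hT : tsupport φ ⊆ ⋃ γ ∈ T, {g : G | (g : G ⧸ ρ.stabilizerSubgroup x) = γ}) :
    π.integratedOperator hu hc μ φ (f x) =
      f (∑ γ ∈ T, (∫ g in {g : G | (g : G ⧸ ρ.stabilizerSubgroup x) = γ}, φ g ∂μ) • ρ γ.out x) := by
  rw [ContRepresentation.integratedOperator_apply]
  have h1 : (fun g => φ g • π g (f x)) = fun g => φ g • f (ρ g x) := by
    funext g
    rw [hf]
  rw [h1, integral_smul_eq_sum_setIntegral_smul (φ := (φ : G → ℂ)) hx
    (fun g k hk => apply_apply_mul_of_mem_stabilizerSubgroup f x g hk) φ.continuous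
    φ.hasCompactSupport hT]
  simp only [_root_.map_sum, map_smul]

/-- `π(φ) (f x) ∈ range f` for a smooth vector `x` and an intertwining `f` (the Hecke sum of
`integratedOperator_apply_eq_sum_of_intertwines`, for some finite covering of the support).
[folklore] -/
theorem ContRepresentation.integratedOperator_apply_mem_range_of_intertwines (hu : π.IsUnitary)
    (hc : π.IsStronglyContinuous) (μ : Measure G) [IsFiniteMeasureOnCompacts μ]
    (f : V →ₗ[ℂ] H) (hf : ∀ (g : G) (y : V), f (ρ g y) = π g (f y)) {x : V}
    (hx : ρ.IsSmoothVector x) (φ : C_c(G, ℂ)) :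
    π.integratedOperator hu hc μ φ (f x) ∈ LinearMap.range f := by
  obtain ⟨T, hT⟩ := exists_finset_tsupport_subset_biUnion_coset (ρ.stabilizerSubgroup x) hx
    φ.hasCompactSupport
  rw [ContRepresentation.integratedOperator_apply_eq_sum_of_intertwines hu hc μ f hf hx φ hT]
  exact LinearMap.mem_range_self f _

/-- For an **injective** intertwining `f` (e.g. `ρ` irreducible and `f ≠ 0`), `π(φ) (f x) = 0`
iff the Hecke sum `Σ_{γ ∈ T} (∫_{γK} φ) • ρ(γ.out) x` vanishes — the non-vanishing of `R(Φ)` on a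
constituent with a given local component is an algebraic statement about that component.
[folklore] -/
theorem ContRepresentation.integratedOperator_apply_eq_zero_iff_of_intertwines (hu : π.IsUnitary)
    (hc : π.IsStronglyContinuous) (μ : Measure G) [IsFiniteMeasureOnCompacts μ]
    (f : V →ₗ[ℂ] H) (hf : ∀ (g : G) (y : V), f (ρ g y) = π g (f y))
    (hfi : Function.Injective f) {x : V}
    (hx : ρ.IsSmoothVector x) (φ : C_c(G, ℂ)) {T : Finset (G ⧸ ρ.stabilizerSubgroup x)}
    (hT : tsupport φ ⊆ ⋃ γ ∈ T, {g : G | (g : G ⧸ ρ.stabilizerSubgroup x) = γ}) :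
    π.integratedOperator hu hc μ φ (f x) = 0 ↔
      ∑ γ ∈ T, (∫ g in {g : G | (g : G ⧸ ρ.stabilizerSubgroup x) = γ}, φ g ∂μ) • ρ γ.out x = 0 := by
  rw [ContRepresentation.integratedOperator_apply_eq_sum_of_intertwines hu hc μ f hf hx φ hT,
    ← map_zero f]
  exact hfi.eq_iff

/-- **The Hecke sum does not depend on the covering**: two finite sets of cosets covering the
support of `φ` give the same `Σ_{γ ∈ T} (∫_{γK} φ) • ρ(γ.out) x`, both being `∫ φ(g) • F(g) dμ`
for the right-invariant `F(g) = ρ(g) x` viewed in any Banach space through a linear map — here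
through `f` into `H`; stated for injective `f`. [folklore] -/
theorem sum_setIntegral_smul_apply_eq_of_intertwines (hu : π.IsUnitary)
    (hc : π.IsStronglyContinuous) (μ : Measure G) [IsFiniteMeasureOnCompacts μ]
    (f : V →ₗ[ℂ] H) (hf : ∀ (g : G) (y : V), f (ρ g y) = π g (f y))
    (hfi : Function.Injective f) {x : V}
    (hx : ρ.IsSmoothVector x) (φ : C_c(G, ℂ)) {T T' : Finset (G ⧸ ρ.stabilizerSubgroup x)}
    (hT : tsupport φ ⊆ ⋃ γ ∈ T, {g : G | (g : G ⧸ ρ.stabilizerSubgroup x) = γ})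
    (hT' : tsupport φ ⊆ ⋃ γ ∈ T', {g : G | (g : G ⧸ ρ.stabilizerSubgroup x) = γ}) :
    ∑ γ ∈ T, (∫ g in {g : G | (g : G ⧸ ρ.stabilizerSubgroup x) = γ}, φ g ∂μ) • ρ γ.out x =
      ∑ γ ∈ T', (∫ g in {g : G | (g : G ⧸ ρ.stabilizerSubgroup x) = γ}, φ g ∂μ) • ρ γ.out x := by
  apply hfi
  rw [← ContRepresentation.integratedOperator_apply_eq_sum_of_intertwines hu hc μ f hf hx φ hT,
    ← ContRepresentation.integratedOperator_apply_eq_sum_of_intertwines hu hc μ f hf hx φ hT']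

end Representation

end Literature.NumberTheory.Automorphic
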